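/-
Origin: expansion seat `planner-pub-hodgecm-qw8-g11-0`, handover #11 SPLIT PART 2/2 = REPLACE tree `HodgeCM/Model/Toy/LefClosureExclusive.lean` fdc99103 (472 l.) by md5 8e0effae1694c620f8acf0f36ab67099 (343 l.): keeps the module name + module docstring, its earlier sections moved verbatim to rows #10..#10 (LefCoreFree); ONE rewrite: `import Qw8g11.LefCoreFree` -> `import HodgeCM.Model.Toy.LefCoreFree` (row #10); union of the parts' comment-stripped code = the t (`HOME/pub-hodgecm-qw8-g11/lean/Qw8g11/LefClosureExclusive.lean`, md5 8e0effae, 343 lines);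
landed by the packager successor (mc-unitary-1-g3, gen-8 kit) in gate run 32 REPLACES the earlier landed copy of `HodgeCM/Model/Toy/LefClosureExclusive.lean` (import ^import Qw8g11\.LefCoreFree[ \t]*$→import HodgeCM.Model.Toy.LefCoreFree ×1).
-/
-- HANDOVER (planner-pub-hodgecm-qw8-g11-0, unit pub-hodgecm-qw8-g11): SPLIT PART 2/2 = REPLACEMENT of the installed
-- `HodgeCM.Model.Toy.LefClosureExclusive` (md5 fdc99103, 472 l.): §§2–3 (ll. 199–468) verbatim + docstrings; §1 moved to
-- `LefCoreFree`; at landing rewrite `import Qw8g11.LefCoreFree` ↦ `import HodgeCM.Model.Toy.LefCoreFree` (lands AFTER it).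
/-
Copyright (c) 2026. All rights reserved.
Released under Apache 2.0 license as described in the file LICENSE.
-/
import Mathlib
import Summits.HodgeConjecture.HodgeCM.Model.Toy.LefPartialConjGalois
import Summits.HodgeConjecture.HodgeCM.Model.Toy.LefCoreFree

/-!
# Non-biquadratic quartic CM fields are closure-exclusive: the `D₄` case of the mixing criterion

(Split for the 400-line cap: §1 of this file — the group lemma `mem_of_normal_of_coreFree` — is now the module
`HodgeCM.Model.Toy.LefCoreFree`, imported here; §§2–3 below are unchanged.)

`LefPartialConjGalois` reduced the mixing question of the Lefschetz toy model ("do two CM fields `K₁, K₂` have a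
partial conjugation, so that every product of CM abelian varieties over `K₁` with ones over `K₂` satisfies HC in
`lefModel`?") to Galois theory inside `ℚ̄`, and isolated one property of a single field,
`ClosureExclusive K` : every normal subfield `M ⊊ L` of the Galois closure `L` of `K` is pointwise fixed by complex
conjugation `κ`, under which the answer is simply `PartialConj K₁ K₂ ↔ galClosure K₁ ≠ galClosure K₂`
(`partialConj_iff_ne`). It proved `ClosureExclusive` for normal fields with real proper subfields (imaginary
quadratic, cyclic quartic CM) and left the non-normal quartic (`D₄`) case open. This file closes it.

## Contents

1. `mem_of_normal_of_coreFree` — a lemma about an arbitrary group `G` (no finiteness, no counting): if `c` is a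
   central involution, `H ≤ G` a subgroup with `c ∉ H`, `P = H ∪ Hc` "of index two" (any two elements outside `P`
   differ by an element of `P`, and `P ≠ G`), `H` core-free (`⋂ gHg⁻¹ = 1`) and `H ≠ 1`, then `c` lies in every
   nontrivial normal subgroup of `G`. (Model: `G = D₄`, `c = r²`, `H = ⟨s⟩`, `P = ⟨s, r²⟩`.) The proof pins down
   `H = {1, h}` and the relation `g h g⁻¹ = h c` for every `g ∉ P`, from which `c` is a product of two conjugates of
   any `n ≠ 1`.
2. The dictionary for a quartic CM field `K` that is not normal (`closureExclusive_of_not_normal`):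
   `G = Aut_ℚ(ℚ̄) ⧸ Λ` with `Λ` the pointwise stabiliser of `L = galClosure K` (Mathlib `QuotientGroup`), `c = [κ]`
   (central: the twist commutes with conjugation on the embeddings of a CM field, `twist_conjugate`; an involution;
   not in `H` since no embedding of a CM field is real), `H` = the stabiliser of one embedding `a` (core-free by the
   transitivity `exists_twist_eq` and `mem_fixingSubgroup_galClosure_iff`; nontrivial iff `K` is not normal, by the
   infinite Galois correspondence `InfiniteGalois.fixedField_fixingSubgroup`), `P` = the automorphisms sending `a`
   into the pair `{a, ā}` ("index two" = the four embeddings of `K` are `a, ā, b, b̄`,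
   `eq_or_eq_conjugate_of_finrank_eq_four`), and `N` = the stabiliser of the normal subfield generated by the
   conjugates of a given `x ∈ L`.
3. The payoff: `closureExclusive_of_finrank_eq_four` / `closureExclusive_of_finrank_le_four` (CM fields of degree
   `≤ 4` with `NonGenReal`, i.e. not biquadratic), and **the quartic mixing theorem**
   `partialConj_iff_galClosure_ne : PartialConj K₁ K₂ ↔ galClosure K₁ ≠ galClosure K₂` for two such fields, with the
   `lefModel.HC` headlines `lef_hc_prod_of_presented_of_galClosure_ne`, `lef_hc_cmObj_prod_cmObj_of_galClosure_ne`,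
   `lef_hc_prodFin_cmObj_of_galClosure_ne` (finite products over any family of non-biquadratic CM fields of degree
   `≤ 4` with pairwise different closures). The negative half needs no hypothesis: `not_partialConj_of_galClosure_le_cmField`
   (same closure — isomorphic fields, or a `D₄` field and its reflex sister — never mix).

Not treated: biquadratic CM fields `K = K⁺k` (there `ClosureExclusive` fails; their products with other fields are
governed by the imaginary quadratic subfields `k ⊂ K`, cf. `LefQuadMixed`), and CM fields of degree `≥ 6`.

References: Mathlib only (`QuotientGroup`, `IntermediateField.fixingSubgroup`, `InfiniteGalois`). Nothing is
posited; no cited fact; no data.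
-/

noncomputable section

set_option backward.isDefEq.respectTransparency false

namespace HodgeCM.Toy

open NumberField.ComplexEmbedding (conjugate)
open Literature.AlgebraicGeometry.Motives (CMType)

/-! ### 2. The dictionary: a non-normal quartic CM field -/

section Quartic

/-- every complex embedding of a CM field is non-real -/
theorem conjugate_ne_self_cm (K : CMField) (φ : K →+* ℂ) : conjugate φ ≠ φ := fun h =>
  NumberField.IsTotallyComplex.complexEmbedding_not_isReal φ (NumberField.ComplexEmbedding.isReal_iff.mpr h)

/-- `κ` is central in `Aut_ℚ(ℚ̄)` modulo the pointwise stabiliser of the Galois closure of a CM field -/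
theorem commutator_kap_mem (K : CMField) (γ : Gam) :
    (γ * Obj.kap)⁻¹ * (Obj.kap * γ) ∈ (galClosure K).fixingSubgroup := by
  rw [mem_fixingSubgroup_galClosure_iff]
  intro e
  rw [show (γ * Obj.kap)⁻¹ * (Obj.kap * γ) = Obj.kap⁻¹ * (γ⁻¹ * (Obj.kap * γ)) by group, kap_inv, twist_mul,
    twist_mul, twist_mul, twist_kap, twist_kap, twist_conjugate, conjugate_conjugate, ← twist_mul, inv_mul_cancel,
    twist_one]

variable {K : Type} [Field K] [NumberField K] in
/-- the pointwise stabiliser of the image of an embedding `a` is the stabiliser of `a` under the twist -/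
theorem mem_fixingSubgroup_fieldRange_iff (a : K →+* ℂ) (γ : Gam) :
    γ ∈ (liftA K a).fieldRange.fixingSubgroup ↔ twist γ a = a := by
  rw [IntermediateField.mem_fixingSubgroup_iff]
  constructor
  · intro h
    refine RingHom.ext fun y => ?_
    have hy : γ (liftK a y) = liftK a y := h _ ⟨y, rfl⟩
    rw [twist_apply, hy, coe_liftK]
  · rintro h _ ⟨y, rfl⟩
    apply Subtype.ext
    have := congrArg (fun φ : K →+* ℂ => φ y) h
    rwa [twist_apply] at this

variable {K : Type} [Field K] [NumberField K] in
/-- two embeddings outside a conjugate pair `{a, ā}` of a quartic field all of whose embeddings are non-real form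
the other conjugate pair -/
theorem eq_or_eq_conjugate_of_finrank_eq_four (hK : Module.finrank ℚ K = 4) (hcm : ∀ φ : K →+* ℂ, conjugate φ ≠ φ)
    (a e f : K →+* ℂ) (he₁ : e ≠ a) (he₂ : e ≠ conjugate a) (hf₁ : f ≠ a) (hf₂ : f ≠ conjugate a) :
    f = e ∨ f = conjugate e := by
  classical
  by_contra! hf
  have hinj : ∀ φ ψ : K →+* ℂ, conjugate φ = conjugate ψ → φ = ψ := fun φ ψ h => by
    rw [← conjugate_conjugate φ, h, conjugate_conjugate]
  have h5 : ({f, e, conjugate e, a, conjugate a} : Finset (K →+* ℂ)).card = 5 := by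
    rw [Finset.card_insert_of_notMem, Finset.card_insert_of_notMem, Finset.card_insert_of_notMem,
      Finset.card_pair (hcm a).symm]
    · simp only [Finset.mem_insert, Finset.mem_singleton, not_or]
      exact ⟨fun h => he₂ (by rw [← h, conjugate_conjugate]), fun h => he₁ (hinj _ _ h)⟩
    · simp only [Finset.mem_insert, Finset.mem_singleton, not_or]
      exact ⟨(hcm e).symm, he₁, he₂⟩
    · simp only [Finset.mem_insert, Finset.mem_singleton, not_or]
      exact ⟨hf.1, hf.2, hf₁, hf₂⟩
  have := Finset.card_le_univ ({f, e, conjugate e, a, conjugate a} : Finset (K →+* ℂ))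
  rw [h5, NumberField.Embeddings.card, hK] at this
  omega

variable {K : Type} [Field K] [NumberField K] in
/-- a quartic field has, besides `a` and `ā`, a third complex embedding `b ≠ a, ā` -/
theorem exists_ne_ne_conjugate_of_finrank_eq_four (hK : Module.finrank ℚ K = 4) (a : K →+* ℂ) :
    ∃ b : K →+* ℂ, b ≠ a ∧ b ≠ conjugate a := by
  classical
  by_contra! h
  have hsub : (Finset.univ : Finset (K →+* ℂ)) ⊆ {a, conjugate a} := fun b _ => by
    by_cases hb : b = a
    · simp [hb]
    · simp [h b hb]
  have := Finset.card_le_card hsub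
  rw [Finset.card_univ, NumberField.Embeddings.card, hK] at this
  exact absurd (this.trans (Finset.card_le_two)) (by omega)

/-- **A non-normal quartic CM field is closure-exclusive**: every normal subfield of its Galois closure `L`
(`Gal(L/ℚ) ≅ D₄`) other than `L` is (totally) real. -/
theorem closureExclusive_of_not_normal (K : CMField) (hK : Module.finrank ℚ K = 4) (hn : ¬ Normal ℚ K) :
    ClosureExclusive K := by
  classical
  obtain ⟨a⟩ := (inferInstance : Nonempty (K →+* ℂ))
  -- the closure `L`, its stabiliser `Λ ⊴ Γ = Aut_ℚ(ℚ̄)`, and `G = Γ/Λ = Gal(L/ℚ)`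
  set L := galClosure K with hLdef
  set Λ := L.fixingSubgroup with hΛdef
  set Ea := (liftA K a).fieldRange with hEadef
  set Ha := Ea.fixingSubgroup with hHadef
  have hEaL : Ea ≤ L := by
    rintro _ ⟨y, rfl⟩
    exact liftK_mem_galClosure K a y
  have hΛHa : Λ ≤ Ha := fun γ hγ =>
    (IntermediateField.mem_fixingSubgroup_iff _ _).mpr fun x hx =>
      (IntermediateField.mem_fixingSubgroup_iff _ _).mp hγ x (hEaL hx)
  let π : Gam →* Gam ⧸ Λ := QuotientGroup.mk' Λ
  have hπ : Function.Surjective π := QuotientGroup.mk'_surjective Λ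
  have hπeq : ∀ γ δ : Gam, π γ = π δ ↔ γ⁻¹ * δ ∈ Λ := fun γ δ => QuotientGroup.eq
  have hπ1 : ∀ γ : Gam, π γ = 1 ↔ γ ∈ Λ := fun γ => by rw [← MonoidHom.mem_ker, QuotientGroup.ker_mk']
  set c := π Obj.kap with hcdef
  set H := Ha.map π with hHdef
  have memH : ∀ γ : Gam, π γ ∈ H ↔ twist γ a = a := by
    intro γ
    rw [← mem_fixingSubgroup_fieldRange_iff]
    constructor
    · rintro ⟨γ', h', e⟩
      have h1 : γ'⁻¹ * γ ∈ Λ := (hπeq _ _).mp e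
      have := Ha.mul_mem h' (hΛHa h1)
      rwa [mul_inv_cancel_left] at this
    · exact fun h => ⟨γ, h, rfl⟩
  have memHc : ∀ γ : Gam, π γ * c ∈ H ↔ twist γ a = conjugate a := by
    intro γ
    rw [hcdef, ← map_mul, memH, twist_mul, twist_kap, twist_conjugate]
    constructor
    · intro h; rw [← conjugate_conjugate (twist γ a), h]
    · intro h; rw [h, conjugate_conjugate]
  have hz : ∀ x : Gam ⧸ Λ, x * c = c * x := by
    intro x
    obtain ⟨γ, rfl⟩ := hπ x
    rw [hcdef, ← map_mul, ← map_mul, hπeq]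
    exact commutator_kap_mem K γ
  have hcc : c * c = 1 := by rw [hcdef, ← map_mul, kap_mul_kap, map_one]
  have hcH : c ∉ H := by
    rw [hcdef, memH, twist_kap]
    exact conjugate_ne_self_cm K a
  -- `P = H ∪ Hc` = the automorphisms sending `a` into the pair `{a, ā}`
  let P : Subgroup (Gam ⧸ Λ) := adjoinInv c H hz hcc
  have memP : ∀ γ : Gam, π γ ∈ P ↔ twist γ a = a ∨ twist γ a = conjugate a := fun γ => by
    show π γ ∈ H ∨ π γ * c ∈ H ↔ _
    rw [memH, memHc]
  have hidx : ∀ x y : Gam ⧸ Λ, x ∉ P → y ∉ P → x⁻¹ * y ∈ P := by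
    intro x y hx hy
    obtain ⟨γ, rfl⟩ := hπ x
    obtain ⟨δ, rfl⟩ := hπ y
    rw [memP, not_or] at hx hy
    rw [← map_inv, ← map_mul, memP, twist_mul]
    have hγinv : twist γ⁻¹ (twist γ a) = a := by rw [← twist_mul, inv_mul_cancel, twist_one]
    rcases eq_or_eq_conjugate_of_finrank_eq_four hK (conjugate_ne_self_cm K) a (twist γ a) (twist δ a)
      hx.1 hx.2 hy.1 hy.2 with h | h
    · left; rw [h, hγinv]
    · right; rw [h, twist_conjugate, hγinv]
  have hne : ∃ g : Gam ⧸ Λ, g ∉ P := by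
    obtain ⟨b, hb₁, hb₂⟩ := exists_ne_ne_conjugate_of_finrank_eq_four hK a
    obtain ⟨γ, hγ⟩ := exists_twist_eq a b
    exact ⟨π γ, by rw [memP, not_or, hγ]; exact ⟨hb₁, hb₂⟩⟩
  -- core-freeness = transitivity of the twist on embeddings + "fixing every embedding fixes `L`"
  have hcore : ∀ x ∈ H, (∀ g : Gam ⧸ Λ, g * x * g⁻¹ ∈ H) → x = 1 := by
    intro x _ hall
    obtain ⟨γ, rfl⟩ := hπ x
    rw [hπ1, hΛdef, hLdef, mem_fixingSubgroup_galClosure_iff]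
    intro e
    obtain ⟨δ, hδ⟩ := exists_twist_eq e a
    have h2 : twist δ⁻¹ a = e := by rw [← hδ, ← twist_mul, inv_mul_cancel, twist_one]
    have h1 := hall (π δ)
    rw [← map_mul, ← map_inv, ← map_mul, memH, twist_mul, twist_mul, h2] at h1
    -- `h1 : twist δ (twist γ e) = a`
    have h3 := congrArg (twist δ⁻¹) h1
    rwa [← twist_mul, inv_mul_cancel, twist_one, h2] at h3
  -- nontriviality of `H` = non-normality of `K`
  have hH1 : ∃ h ∈ H, h ≠ 1 := by
    by_contra! hall
    apply hn
    have hle : Ha ≤ Λ := fun γ hγ =>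
      (hπ1 γ).mp (hall (π γ) ((memH γ).mpr ((mem_fixingSubgroup_fieldRange_iff a γ).mp hγ)))
    have hLE : L ≤ Ea := by
      have := (IntermediateField.le_iff_le _ _).mpr hle
      rwa [hHadef, InfiniteGalois.fixedField_fixingSubgroup] at this
    have hEq : Ea = L := le_antisymm hEaL hLE
    haveI : Normal ℚ ↥L := galClosure_normal K
    haveI : Normal ℚ ↥Ea := Normal.of_algEquiv (IntermediateField.equivOfEq hEq).symm
    exact Normal.of_algEquiv (equivFieldRange K a).symm
  -- the element `x ∈ L` and the normal subfield `M ∋ x` generated by its conjugates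
  intro x hx
  by_cases hM : L ≤ IntermediateField.normalClosure ℚ ↥(IntermediateField.adjoin ℚ {x}) Qbar
  · exact Or.inr hM
  left
  set M := IntermediateField.normalClosure ℚ ↥(IntermediateField.adjoin ℚ {x}) Qbar with hMdef
  haveI : Normal ℚ ↥L := galClosure_normal K
  have hML : M ≤ L :=
    calc M ≤ IntermediateField.normalClosure ℚ ↥L Qbar :=
          IntermediateField.normalClosure_mono _ _ (IntermediateField.adjoin_simple_le_iff.mpr hx)
      _ = L := IntermediateField.normalClosure_of_normal _
  have hxM : x ∈ M := IntermediateField.le_normalClosure _ (IntermediateField.mem_adjoin_simple_self ℚ x)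
  haveI : Normal ℚ ↥M := by rw [hMdef]; infer_instance
  haveI : IsGalois ℚ ↥M := IsGalois.mk
  haveI hMn : M.fixingSubgroup.Normal := (InfiniteGalois.normal_iff_isGalois _).mpr inferInstance
  set N := M.fixingSubgroup.map π with hNdef
  haveI : N.Normal := hMn.map π hπ
  have hN1 : ∃ n ∈ N, n ≠ 1 := by
    by_contra! hall
    apply hM
    have hle : M.fixingSubgroup ≤ Λ := fun γ hγ => (hπ1 γ).mp (hall _ ⟨γ, hγ, rfl⟩)
    have := (IntermediateField.le_iff_le _ _).mpr hle
    rwa [InfiniteGalois.fixedField_fixingSubgroup] at this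
  obtain ⟨γ, hγ, e⟩ :=
    Subgroup.mem_map.mp (mem_of_normal_of_coreFree hz hcc hcH P (fun _ => Iff.rfl) hidx hne hcore hH1 N hN1)
  have hγκ : γ⁻¹ * Obj.kap ∈ Λ := (hπeq _ _).mp (e.trans hcdef)
  have h1 : (γ⁻¹ * Obj.kap) x = x := (IntermediateField.mem_fixingSubgroup_iff _ _).mp hγκ x hx
  have h2 : γ x = x := (IntermediateField.mem_fixingSubgroup_iff _ _).mp hγ x hxM
  calc Obj.kap x = γ ((γ⁻¹ * Obj.kap) x) := by
        rw [AlgEquiv.mul_apply, ← AlgEquiv.mul_apply γ γ⁻¹, mul_inv_cancel, AlgEquiv.one_apply]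
    _ = x := by rw [h1, h2]

end Quartic

/-! ### 3. Quartic CM fields with a unique quadratic subfield, and the quartic mixing theorem -/

section Payoff

/-- **A quartic CM field all of whose quadratic subfields are real (`NonGenReal`: equivalently, not biquadratic) is
closure-exclusive** — cyclic ones by `closureExclusive_of_normal`, non-normal (`D₄`) ones by
`closureExclusive_of_not_normal`. (For a biquadratic CM field the statement is false: its imaginary quadratic
subfields are proper normal non-real subfields of the closure.) -/
theorem closureExclusive_of_finrank_eq_four (K : CMField) (hK : Module.finrank ℚ K = 4) (hng : NonGenReal K) :
    ClosureExclusive K := by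
  by_cases hn : Normal ℚ K
  · exact closureExclusive_of_normal K hng
  · exact closureExclusive_of_not_normal K hK hn

/-- a CM field of degree `≤ 4` has degree `2` or `4` -/
theorem finrank_eq_two_or_four (K : CMField) (hd : Module.finrank ℚ K ≤ 4) :
    Module.finrank ℚ K = 2 ∨ Module.finrank ℚ K = 4 := by
  have h := NumberField.IsTotallyComplex.finrank (K := K)
  have hpos : 0 < Module.finrank ℚ K := Module.finrank_pos
  omega

/-- **CM fields of degree `≤ 4` that are not biquadratic are closure-exclusive.** -/
theorem closureExclusive_of_finrank_le_four (K : CMField) (hd : Module.finrank ℚ K ≤ 4) (hng : NonGenReal K) :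
    ClosureExclusive K := by
  rcases finrank_eq_two_or_four K hd with h | h
  · exact closureExclusive_of_finrank_eq_two K h
  · exact closureExclusive_of_finrank_eq_four K h hng

/-- a CM field never mixes with a field whose Galois closure contains its own (in particular: with itself, with an
isomorphic copy, with its `D₄` reflex sister) — the `CMField` form of `not_partialConj_of_galClosure_le` -/
theorem not_partialConj_of_galClosure_le_cmField {K₁ : Type} [Field K₁] [NumberField K₁] (K₂ : CMField)
    (h : galClosure K₂ ≤ galClosure K₁) : ¬ PartialConj K₁ K₂ := by
  obtain ⟨b⟩ := (inferInstance : Nonempty (K₂ →+* ℂ))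
  obtain ⟨y, hy⟩ : ∃ y : K₂, starRingEnd ℂ (b y) ≠ b y := by
    by_contra! hall
    exact conjugate_ne_self_cm K₂ b
      (RingHom.ext fun y => by rw [NumberField.ComplexEmbedding.conjugate_coe_eq]; exact hall y)
  exact not_partialConj_of_mem_galClosure b y (h (liftK_mem_galClosure K₂ b y)) hy

/-- **THE QUARTIC MIXING THEOREM.** Two CM fields of degree `≤ 4`, neither of them biquadratic (`NonGenReal`), have
a partial conjugation — equivalently (`LefPartialConj`) every product of CM abelian varieties presented over the one
with CM abelian varieties presented over the other satisfies HC in the Lefschetz model — **iff their Galois closures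
in `ℚ̄` are different.** ("Same closure" covers: isomorphic fields, and a `D₄` field with its reflex sister.) -/
theorem partialConj_iff_galClosure_ne (K₁ K₂ : CMField) (h₁ : Module.finrank ℚ K₁ ≤ 4)
    (h₂ : Module.finrank ℚ K₂ ≤ 4) (hn₁ : NonGenReal K₁) (hn₂ : NonGenReal K₂) :
    PartialConj K₁ K₂ ↔ galClosure K₁ ≠ galClosure K₂ :=
  ⟨fun hc he => not_partialConj_of_galClosure_le_cmField K₂ he.ge hc, partialConj_of_ne
    (closureExclusive_of_finrank_le_four K₁ h₁ hn₁) (closureExclusive_of_finrank_le_four K₂ h₂ hn₂)⟩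

/-- **HEADLINE.** Products over two non-biquadratic CM fields of degree `≤ 4` with different Galois closures. -/
theorem lef_hc_prod_of_presented_of_galClosure_ne (K₁ K₂ : CMField) (h₁ : Module.finrank ℚ K₁ ≤ 4)
    (h₂ : Module.finrank ℚ K₂ ≤ 4) (hn₁ : NonGenReal K₁) (hn₂ : NonGenReal K₂)
    (hne : galClosure K₁ ≠ galClosure K₂) {X Y : Obj} (hX : X.Presented K₁) (hY : Y.Presented K₂) :
    lefModel.HC (X.prod Y) :=
  lef_hc_prod_of_presented_of_ne K₁ K₂ (closureExclusive_of_finrank_le_four K₁ h₁ hn₁)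
    (closureExclusive_of_finrank_le_four K₂ h₂ hn₂) hne h₁ h₂ hX hY

/-- products `cmObj K₁ Φ × cmObj K₂ Φ'` of CM abelian varieties over two non-biquadratic CM fields
of degree `≤ 4` with different Galois closures satisfy HC in `lefModel` (any CM types `Φ, Φ'`) -/
theorem lef_hc_cmObj_prod_cmObj_of_galClosure_ne (K₁ K₂ : CMField) (h₁ : Module.finrank ℚ K₁ ≤ 4)
    (h₂ : Module.finrank ℚ K₂ ≤ 4) (hn₁ : NonGenReal K₁) (hn₂ : NonGenReal K₂)
    (hne : galClosure K₁ ≠ galClosure K₂) (Φ : CMType K₁) (Φ' : CMType K₂) :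
    lefModel.HC ((cmObj K₁ Φ).prod (cmObj K₂ Φ')) :=
  lef_hc_cmObj_prod_cmObj_of_ne K₁ K₂ (closureExclusive_of_finrank_le_four K₁ h₁ hn₁)
    (closureExclusive_of_finrank_le_four K₂ h₂ hn₂) hne h₁ h₂ Φ Φ'

/-- **HEADLINE (family form).** Any finite product of CM abelian varieties `cmObj (Ks (c j)) (Θ j)` over
non-biquadratic CM fields of degree `≤ 4` with pairwise different Galois closures satisfies HC in `lefModel`
(repetitions `c j = c j'` allowed: same-field factors are handled by `LefPartialConj`). -/
theorem lef_hc_prodFin_cmObj_of_galClosure_ne {ι : Type} (Ks : ι → CMField)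
    (hd : ∀ a, Module.finrank ℚ (Ks a) ≤ 4) (hn : ∀ a, NonGenReal (Ks a))
    (h : ∀ a b, a ≠ b → galClosure (Ks a) ≠ galClosure (Ks b))
    {n : ℕ} (c : Fin (n + 1) → ι) (Θ : ∀ j, CMType (Ks (c j))) :
    lefModel.HC (lefModel.prodFin n fun j => cmObj (Ks (c j)) (Θ j)) :=
  lef_hc_prodFin_cmObj_of_ne Ks hd (fun a => closureExclusive_of_finrank_le_four (Ks a) (hd a) (hn a)) h c Θ

end Payoff

end HodgeCM.Toy

end
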